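import Summits.MatrixMultiplication.OmegaCensus.STPPTightN18CriticalPair
import Literature.Combinatorics.Additive.CriticalSumProgressionOrQuasiPeriodic

/-!
# ω-census (abelian STPP census): critical pairs in ANY finite abelian group — progression, or a full coset inside the sum (kernel tool)

HONEST FRAMING (pub-omega census; verbatim): lottery ticket; floor = certified bounds/negative ranges.
Census STRUCTURE (seat pub-omega-stpp-2 gen 32, 2026-08-30), family (b2).  The order-generic form of the first step of the order-`46` analysis
(`STPPCriticalPairsZ46.lean`), for the successors working the N18-tight residual patterns of orders `45`, `48`, `49`, …: by Kemperman's Theorem 2.1 (tree: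
`isAP_or_isQuasiPeriodic_add_of_card_add_le`) the sum of a critical pair (`|A + B| + 1 ≤ |A| + |B|`, `|A|, |B| ≥ 2`) is an ARITHMETIC PROGRESSION or contains a
FULL COSET `x + F` of a nontrivial subgroup `F` (the periodic part of a quasi-periodic decomposition is non-empty) — so `|F| ≤ |A + B|`, which at a given group order
leaves a short list of subgroups to examine (`isAP_or_exists_coset_subset`, `natCard_le_of_coset_subset`).  Combined with `inner_critical_of_n18_tight`
(`STPPTightN18CriticalPair.lean`) this is the entry point of the critical-pair route at every composite order.  Nothing here is progress on `ω`.

References: J. H. B. Kemperman, Acta Math. 103 (1960), Thm 2.1; D. J. Grynkiewicz, Mathematika 55 (2009), §2 (quasi-periodic decompositions; tree vocabulary).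
-/

open Finset
open scoped Pointwise

namespace Summit.MatrixMultiplication.OmegaCensus.CubeNB

open Literature.Combinatorics.Additive

variable {G : Type*} [AddCommGroup G] [Fintype G] [DecidableEq G]

/-- **Critical pair ⇒ progression or a full coset inside the sum.**  For `|A|, |B| ≥ 2` and `|A + B| + 1 ≤ |A| + |B|` in a finite abelian group: either `A + B`
is an arithmetic progression, or there are a nontrivial subgroup `F` and an `x` with `x + F ⊆ A + B`. [cite: Kemperman1960, Thm 2.1] [cite: Grynkiewicz2009, §2] -/
theorem isAP_or_exists_coset_subset {A B : Finset G} (hA : 2 ≤ #A) (hB : 2 ≤ #B) (hcrit : #(A + B) + 1 ≤ #A + #B) :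
    (∃ d, IsAP (A + B) d) ∨ ∃ F : AddSubgroup G, F ≠ ⊥ ∧ ∃ x : G, ∀ f ∈ F, x + f ∈ A + B := by
  rcases isAP_or_isQuasiPeriodic_add_of_card_add_le hA hB hcrit with h | ⟨F, P₁, P₀, hd, hne⟩
  · exact Or.inl h
  · refine Or.inr ⟨F, hd.ne_bot, ?_⟩
    obtain ⟨x, hx⟩ := hne
    refine ⟨x, fun f hf => ?_⟩
    have hP : f +ᵥ P₁ = P₁ := hd.periodic f hf
    have hxf : x + f ∈ P₁ := by
      rw [← hP]
      exact Finset.mem_vadd_finset.2 ⟨x, hx, by rw [vadd_eq_add, add_comm]⟩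
    exact hd.left_subset hxf

/-- The subgroup of a coset contained in a finite set has at most that many elements. [folklore] -/
theorem natCard_le_of_coset_subset {S : Finset G} {F : AddSubgroup G} {x : G} (h : ∀ f ∈ F, x + f ∈ S) : Nat.card F ≤ #S := by
  classical
  have hfin : (F : Set G).Finite := Set.toFinite _
  obtain ⟨Ff, hFf, hcard⟩ := exists_finset_carrier (H := F) hfin
  rw [← hcard]
  have hinj : Function.Injective (fun f : G => x + f) := add_right_injective x
  calc #Ff = #(Ff.image fun f => x + f) := (Finset.card_image_of_injective _ hinj).symm
    _ ≤ #S := Finset.card_le_card (fun y hy => by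
        obtain ⟨f, hf, rfl⟩ := Finset.mem_image.1 hy
        exact h f ((hFf f).1 hf))

/-- **Corollary (the form used per order).**  If no nontrivial subgroup of order `≤ |A + B|` has a coset inside `A + B` — e.g. because every nontrivial subgroup
is larger than `|A + B|`, or by a direct argument — then a critical sum is an arithmetic progression. [cite: Kemperman1960, Thm 2.1] -/
theorem isAP_of_critical_of_no_coset {A B : Finset G} (hA : 2 ≤ #A) (hB : 2 ≤ #B) (hcrit : #(A + B) + 1 ≤ #A + #B)
    (hno : ∀ F : AddSubgroup G, F ≠ ⊥ → Nat.card F ≤ #(A + B) → ∀ x : G, ¬ ∀ f ∈ F, x + f ∈ A + B) : ∃ d, IsAP (A + B) d := by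
  rcases isAP_or_exists_coset_subset hA hB hcrit with h | ⟨F, hF, x, hx⟩
  · exact h
  · exact absurd hx (hno F hF (natCard_le_of_coset_subset hx) x)

end Summit.MatrixMultiplication.OmegaCensus.CubeNB
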